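import Summits.AtomisticToContinuum.BoseEinsteinCondensation.Theses.BECCutLineWeakDisorder

/-!
# Crux `WitnessTransfer` (stmt-AtomisticToContinuum-14978) — the engine clause is free on the junk witness

Crux-disprover result (route BECCutLineWeakDisorder, seat
`refuter-cdisprove-stmt-AtomisticToContinuum-14978-0`), the VACUITY CHANNEL of the crux
`WitnessTransfer = (TwoReplicaTransienceBound → LandscapeBound)` made precise (small-model fact):

* `fkWitness_eq_zero_of_fkNormSq_eq_zero` — if `‖e^{-TH_N}1‖₂² = fkNormSq v L T 1 = 0` then the
  finite-`T` Feynman–Kac witness `fkWitness v L T 1` is the JUNK function `0` (`x / √0 = 0`);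
* `twoReplicaIntegrand_eq_zero_of_fkNormSq_eq_zero` — for the junk witness every slice of the engine
  integrand `L³ m_T(Y)²/s_T(Y)²` is `0/0 = 0`;
* `twoReplicaClause_of_degenerate` — hence wherever the witnesses are degenerate (eventually in `n`, all
  `T ≥ 1`) the engine clause of `TwoReplicaTransienceBound` at `(v, ρ)` holds with EVERY real constant
  `C`, carrying no information: on such potentials the transfer must produce the hinge from nothing.
  (Companion: `Negative/LandscapeRatioFloor.lean` shows conversely that an engine constant `< 1` FORCES
  degeneracy; and at low density the channel is closed, `‖e^{-TH}1‖₂ > 0`, by the line's lower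
  envelope — see the crux workfile `Cruxes/WitnessTransfer/Disproof.lean` §1.)

All [folklore].
-/

noncomputable section

open MeasureTheory Filter Set
open scoped ENNReal NNReal

namespace Summit.AtomisticToContinuum.BoseEinsteinCondensation.Theorems.WitnessTransfer.Negative

open Literature.MathematicalPhysics.QuantumManyBody.BoseGas

variable {n : ℕ}

/-- **The junk witness.** If `‖e^{-TH}1‖₂² = 0` then `fkWitness v L T 1 ≡ 0` (`x / √0 = x / 0 = 0`).
[folklore] -/
theorem fkWitness_eq_zero_of_fkNormSq_eq_zero {N : ℕ} (v : ℝ → ℝ≥0∞) (L T : ℝ)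
    (h : fkNormSq (N := N) v L T (fun _ => 1) = 0) (X : Config N) :
    fkWitness (N := N) v L T (fun _ => 1) X = 0 := by
  simp [fkWitness_apply, h]

/-- **The vacuity channel, slice by slice**: for the junk witness the engine integrand is `0/0 = 0`.
[folklore] -/
theorem twoReplicaIntegrand_eq_zero_of_fkNormSq_eq_zero {v : ℝ → ℝ≥0∞} {L T : ℝ}
    (h : fkNormSq (N := n + 1) v L T (fun _ => 1) = 0) (Y : Config n) :
    ENNReal.ofReal (L ^ 3) *
        (∫⁻ x, (‖fkWitness (N := n + 1) v L T (fun _ => (1 : ℝ≥0∞)) (Matrix.vecCons x Y)‖₊ :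
          ℝ≥0∞) ^ 2) ^ 2 /
        (∫⁻ x, (‖fkWitness (N := n + 1) v L T (fun _ => (1 : ℝ≥0∞)) (Matrix.vecCons x Y)‖₊ :
          ℝ≥0∞)) ^ 2 = 0 := by
  simp [fkWitness_eq_zero_of_fkNormSq_eq_zero v L T h]

/-- **The engine clause is FREE wherever the witness is junk**: if eventually in `n` the witnesses are
degenerate for all `T ≥ 1`, the engine inequality of `TwoReplicaTransienceBound` at `(v, ρ)` (verbatim
the part of the route decl after `∃ C : ℝ, 0 < C ∧`) holds with EVERY constant `C` (even `C ≤ 0`).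
[folklore] -/
theorem twoReplicaClause_of_degenerate {v : ℝ → ℝ≥0∞} {ρ : ℝ}
    (h : ∀ᶠ n : ℕ in Filter.atTop, ∀ T : ℝ, 1 ≤ T →
      fkNormSq (N := n + 1) v (sideLength ρ (n + 1)) T (fun _ => 1) = 0) (C : ℝ) :
    ∀ᶠ n : ℕ in Filter.atTop, ∀ T : ℝ, 1 ≤ T →
      ∫⁻ Y : Config n, ENNReal.ofReal (sideLength ρ (n + 1) ^ 3) *
          (∫⁻ x, (‖fkWitness (N := n + 1) v (sideLength ρ (n + 1)) T (fun _ => (1 : ENNReal))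
            (Matrix.vecCons x Y)‖₊ : ENNReal) ^ 2) ^ 2 /
          (∫⁻ x, (‖fkWitness (N := n + 1) v (sideLength ρ (n + 1)) T (fun _ => (1 : ENNReal))
            (Matrix.vecCons x Y)‖₊ : ENNReal)) ^ 2 ≤ ENNReal.ofReal C := by
  filter_upwards [h] with n hn T hT
  simp [twoReplicaIntegrand_eq_zero_of_fkNormSq_eq_zero (hn T hT)]

end Summit.AtomisticToContinuum.BoseEinsteinCondensation.Theorems.WitnessTransfer.Negative

end
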